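import Summits.PneNP.PneNP.Theorems.RamseyUncertifiableRegularResolutionRungDefs
import Summits.PneNP.PneNP.Theorems.RamseyUncertifiableRegularResolutionRungCoinCounting
import Summits.PneNP.PneNP.Theorems.RamseyUncertifiableRegularResolutionRungResDag

/-!
# Route RamseyUncertifiable, crux `RegularResolutionRung` (stmt-PneNP-9818), line `sound-path-bottleneck`:
# the path process `D*` on a regular refutation of `Clique(H,k)` (definitions and structural invariants)

Auxiliary file 3 for the registered stub `stub_soundPathCount`: the modified path distribution `D*` of
the line (Atserias–Bonacina–de Rezende–Lauria–Nordström–Razborov, arXiv:2012.09476 §6, p. 15, with the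
three changes of the line), written as an instance of the coin-driven process `mrun` of
`…RungCoinCounting.lean` over the coin cube `Fin k × Fin m → Bool` (one `p₁`-coin per variable `x_{i,v}`).

The walk starts at the first line with the empty clause and follows the DAG of the refutation towards the
axioms: at a weakening line it passes to the premise; at a resolution line with pivot `x` it ANSWERS `x`
and moves to the premise falsified by the answer. The answer to a non-block variable is `0`; for
`x = x_{i,v}` it is `0` if (F0) block `i` already has an accepted vertex, (F1) a 2-clause of the formula
containing `¬x` has the negation of its other literal already in the current clause, or (F2) `v` is junk
for the accepted set (`|N̂(U' ∪ {v})| < δ|N̂(U')|` for some `U' ⊆ ACC`, `|U'| ≤ L₀`); otherwise the coin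
`c (i,v)` is READ and is the answer (answer `1` = "accept `v`").

Contents: the data `Ctx`, events `Ev`, states `PState`, the forcing rules (`Bool`-valued), the step
(`Ctx.query`, `Ctx.next`, `Ctx.run`) and its trichotomy `Ctx.mstep_cases`. The invariants of the run are in
the sequels (`…RungPathStruct.lean`, `…RungPathFacts.lean`). No propositions are defined; the registered
sub-goal `spc_process_anchor` credits the file. [folklore]
-/

set_option linter.dupNamespace false -- `Summit.PneNP.PneNP.…`: single-conjunct summit

noncomputable section

open scoped BigOperators

namespace Summit.PneNP.PneNP.Cruxes.RegularResolutionRung.SoundPathBottleneck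

open Finset
open Literature.Computability.MetaComplexity Literature.Computability.Complexity
open Summit.PneNP.PneNP.Theorems.RegularResolutionRung.Negative (cliqueCNF)

/-! ## Data, events, states -/

/-- The fixed data of the path process on `m` vertices: the graph `H` (with its adjacency decision
procedure), the soundness parameters `δ, L₀`, the number of blocks `k` and the refutation `π`. -/
structure Ctx (m : ℕ) where
  /-- the graph -/
  H : SimpleGraph (Fin m)
  /-- its adjacency decision procedure -/
  dec : DecidableRel H.Adj
  /-- density kept by a sound vertex -/
  δ : ℝ
  /-- size bound of the reference sets of the junk test -/
  L₀ : ℕ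
  /-- number of blocks (clique size) -/
  k : ℕ
  /-- the refutation walked on -/
  π : List (ResLine ℕ)

/-- An EVENT of the walk: at line `node` the pivot `var` was answered `ans`; `coin` records whether the
answer was read off the coin of the variable (otherwise it was forced to `0`). -/
structure Ev where
  /-- the resolution line at which the query happened -/
  node : ℕ
  /-- the pivot variable answered -/
  var : ℕ
  /-- the answer -/
  ans : Bool
  /-- whether the answer is a coin read -/
  coin : Bool
  deriving DecidableEq

/-- A STATE of the walk: the nodes visited so far (in order, excluding the current one), the current node,
and the events so far (in order). -/
structure PState where
  /-- visited nodes, chronological, excluding the current node -/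
  vis : List ℕ
  /-- current node -/
  cur : ℕ
  /-- events so far, chronological -/
  hist : List Ev

variable {m : ℕ} (X : Ctx m)

/-- The adjacency decision procedure carried by the data. -/
instance : DecidableRel X.H.Adj := X.dec

/-- The Boolean adjacency fed to `cliqueCNF`. -/
def Ctx.adj : Fin m → Fin m → Bool := fun u v => decide (X.H.Adj u v)

/-- The refuted formula `Clique(H,k)`. -/
def Ctx.cnf : CNF ℕ := cliqueCNF m X.k X.adj

/-- The clause at a line index (`∅` out of range). -/
def Ctx.clauseAt (a : ℕ) : Finset (Literal ℕ) := if h : a < X.π.length then (X.π[a]).clause else ∅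

/-- `clauseAt` in range. -/
theorem Ctx.clauseAt_eq {a : ℕ} (h : a < X.π.length) : X.clauseAt a = (X.π[a]).clause := dif_pos h

/-- The vertex ACCEPTED by an event (answer `1` to a block variable), if any. -/
def Ctx.accV (e : Ev) : Option (Fin m) := if e.ans then (decodeVar X.k m e.var).map Prod.snd else none

/-- The block of an event's variable, if it is a block variable. -/
def Ctx.blk (e : Ev) : Option (Fin X.k) := (decodeVar X.k m e.var).map Prod.fst

/-- The coin read by an event, if it is a coin read. -/
def Ctx.coinOf (e : Ev) : Option (Fin X.k × Fin m) := if e.coin then decodeVar X.k m e.var else none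

/-- The accepted vertices of a history, in order of acceptance. -/
def Ctx.acc (h : List Ev) : List (Fin m) := h.filterMap X.accV

open scoped Classical in
/-- (F0) block `i` already has an acceptance in the history `h`. -/
def Ctx.f0 (i : Fin X.k) (h : List Ev) : Bool := decide (∃ e ∈ h, e.ans = true ∧ X.blk e = some i)

open scoped Classical in
/-- (F1) some 2-clause `{¬x_{i,v}, ¬y}` of the formula (functionality: `y = x_{i,w}`, `w ≠ v`; edge:
`y = x_{j,w}`, `j ≠ i`, `v,w` non-adjacent, in either orientation) has `(y,false)` in the clause at `a`. -/
def Ctx.f1 (a : ℕ) (i : Fin X.k) (v : Fin m) : Bool :=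
  decide (∃ y, (y, false) ∈ X.clauseAt a ∧ ∃ (j : Fin X.k) (w : Fin m), decodeVar X.k m y = some (j, w) ∧
    ((j = i ∧ w ≠ v) ∨ (j ≠ i ∧ (X.adj v w = false ∨ X.adj w v = false))))

open scoped Classical in
/-- (F2) `v` is JUNK for the accepted set of `h`: it loses more than a `(1-δ)`-fraction of the common
neighbourhood of some `≤ L₀`-subset of the accepted vertices. -/
def Ctx.f2 (v : Fin m) (h : List Ev) : Bool :=
  decide (∃ U ⊆ (X.acc h).toFinset, U.card ≤ X.L₀ ∧
    ((commonNbhd X.H (insert v U)).card : ℝ) < X.δ * (commonNbhd X.H U).card)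

/-- The answer to `x_{i,v}` at node `a` with history `h` is FORCED (to `0`). -/
def Ctx.forced (a : ℕ) (i : Fin X.k) (v : Fin m) (h : List Ev) : Bool :=
  X.f0 i h || X.f1 a i v || X.f2 v h

/-- The coin to read when answering pivot `x` at node `a` with history `h` (none if `x` is not a block
variable or the answer is forced). -/
def Ctx.toRead (a x : ℕ) (h : List Ev) : Option (Fin X.k × Fin m) :=
  match decodeVar X.k m x with
  | some iv => if X.forced a iv.1 iv.2 h then none else some iv
  | none => none

/-- The answer and the coin flag for pivot `x` at node `a` with history `h` under the coins `c`. -/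
def Ctx.answer (c : Fin X.k × Fin m → Bool) (a x : ℕ) (h : List Ev) : Bool × Bool :=
  match X.toRead a x h with
  | some iv => (c iv, true)
  | none => (false, false)

/-- The query of the process at state `s`: the coin to read, if the current line is a resolution line
whose answer is not forced. -/
def Ctx.query (s : PState) : Option (Fin X.k × Fin m) :=
  match X.π[s.cur]? with
  | none => none
  | some l => match l.rule with
    | .resolve _ _ x => X.toRead s.cur x s.hist
    | _ => none

/-- The transition of the process at state `s` given the coin value `b` (ignored unless a coin is read):
stay at an initial line; pass to the premise of a weakening; at a resolution line answer the pivot and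
move to the premise falsified by the answer (`i` — containing the positive literal — on `0`, `j` on `1`). -/
def Ctx.next (s : PState) (b : Bool) : PState :=
  match X.π[s.cur]? with
  | none => s
  | some l => match l.rule with
    | .initial => s
    | .weaken i => ⟨s.vis ++ [s.cur], i, s.hist⟩
    | .resolve i j x =>
      ⟨s.vis ++ [s.cur], if (X.toRead s.cur x s.hist).isSome && b then j else i,
        s.hist ++ [⟨s.cur, x, (X.toRead s.cur x s.hist).isSome && b, (X.toRead s.cur x s.hist).isSome⟩]⟩

/-- The start node: the first line with the empty clause. -/
def Ctx.a₀ : ℕ := X.π.findIdx fun l => l.clause = ∅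

/-- The initial state. -/
def Ctx.init : PState := ⟨[], X.a₀, []⟩

/-- The state of the path process after `n` steps on the coins `c`. -/
def Ctx.run (c : Fin X.k × Fin m → Bool) (n : ℕ) : PState := mrun X.query X.next c X.init n

/-! ## The step -/

section Step

variable {X}

/-- Components of `answer`: the coin flag is `isSome` of the coin to read. -/
theorem Ctx.answer_snd (c : Fin X.k × Fin m → Bool) (a x : ℕ) (h : List Ev) :
    (X.answer c a x h).2 = (X.toRead a x h).isSome := by
  unfold Ctx.answer; cases X.toRead a x h <;> rfl

/-- A coin to read is the decoded (block) variable, and the answer is then not forced. -/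
theorem Ctx.toRead_eq_some {a x : ℕ} {h : List Ev} {iv : Fin X.k × Fin m} (htr : X.toRead a x h = some iv) :
    decodeVar X.k m x = some iv ∧ X.forced a iv.1 iv.2 h = false := by
  unfold Ctx.toRead at htr
  cases hd : decodeVar X.k m x with
  | none => rw [hd] at htr; exact absurd htr (by simp)
  | some iv' =>
    rw [hd] at htr
    simp only at htr
    split_ifs at htr with hf
    cases htr; exact ⟨rfl, by simpa using hf⟩

/-- If the answer is a coin read, the coin exists, is the decoded variable, and the answer is its value. -/
theorem Ctx.answer_of_coin {c : Fin X.k × Fin m → Bool} {a x : ℕ} {h : List Ev}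
    (hc : (X.answer c a x h).2 = true) :
    ∃ iv, X.toRead a x h = some iv ∧ decodeVar X.k m x = some iv ∧ (X.answer c a x h).1 = c iv ∧
      X.forced a iv.1 iv.2 h = false := by
  unfold Ctx.answer at hc ⊢
  cases htr : X.toRead a x h with
  | none => rw [htr] at hc; exact absurd hc (by simp)
  | some iv =>
    obtain ⟨hd, hf⟩ := Ctx.toRead_eq_some htr
    exact ⟨iv, rfl, hd, rfl, hf⟩

/-- If the answer is not a coin read, it is `0`, and either `x` is not a block variable or it was forced. -/
theorem Ctx.answer_of_not_coin {c : Fin X.k × Fin m → Bool} {a x : ℕ} {h : List Ev}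
    (hc : (X.answer c a x h).2 = false) :
    (X.answer c a x h).1 = false ∧
      (decodeVar X.k m x = none ∨ ∃ iv, decodeVar X.k m x = some iv ∧ X.forced a iv.1 iv.2 h = true) := by
  unfold Ctx.answer at hc ⊢
  cases htr : X.toRead a x h with
  | some iv => rw [htr] at hc; exact absurd hc (by simp)
  | none =>
    refine ⟨rfl, ?_⟩
    unfold Ctx.toRead at htr
    cases hd : decodeVar X.k m x with
    | none => exact Or.inl rfl
    | some iv =>
      rw [hd] at htr; simp only at htr
      split_ifs at htr with hf
      exact Or.inr ⟨iv, rfl, hf⟩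

/-- An accepting answer is a coin read. -/
theorem Ctx.coin_of_ans {c : Fin X.k × Fin m → Bool} {a x : ℕ} {h : List Ev}
    (ha : (X.answer c a x h).1 = true) : (X.answer c a x h).2 = true := by
  by_contra hc
  rw [Bool.not_eq_true] at hc
  rw [(Ctx.answer_of_not_coin hc).1] at ha
  exact Bool.false_ne_true ha

/-- STEP TRICHOTOMY: at a valid current index the process stays (initial line), passes to the premise
(weakening), or answers the pivot as `answer` says and records the event (resolution). -/
theorem Ctx.mstep_cases (c : Fin X.k × Fin m → Bool) (s : PState) (hcur : s.cur < X.π.length) :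
    ((X.π[s.cur]).rule = .initial ∧ mstep X.query X.next c s = s ∧ X.query s = none) ∨
    (∃ i, (X.π[s.cur]).rule = .weaken i ∧ mstep X.query X.next c s = ⟨s.vis ++ [s.cur], i, s.hist⟩ ∧
      X.query s = none) ∨
    (∃ i j x, (X.π[s.cur]).rule = .resolve i j x ∧
      mstep X.query X.next c s = ⟨s.vis ++ [s.cur], if (X.answer c s.cur x s.hist).1 then j else i,
        s.hist ++ [⟨s.cur, x, (X.answer c s.cur x s.hist).1, (X.answer c s.cur x s.hist).2⟩]⟩ ∧
      X.query s = X.toRead s.cur x s.hist) := by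
  have hq : X.query s = match (X.π[s.cur]).rule with
      | .resolve _ _ x => X.toRead s.cur x s.hist | _ => none := by
    unfold Ctx.query; rw [List.getElem?_eq_getElem hcur]
  have hn : ∀ b, X.next s b = match (X.π[s.cur]).rule with
      | .initial => s
      | .weaken i => ⟨s.vis ++ [s.cur], i, s.hist⟩
      | .resolve i j x =>
        ⟨s.vis ++ [s.cur], if (X.toRead s.cur x s.hist).isSome && b then j else i,
          s.hist ++ [⟨s.cur, x, (X.toRead s.cur x s.hist).isSome && b, (X.toRead s.cur x s.hist).isSome⟩]⟩ := by
    intro b; unfold Ctx.next; rw [List.getElem?_eq_getElem hcur]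
  cases hr : (X.π[s.cur]).rule with
  | initial =>
    refine Or.inl ⟨rfl, ?_, by rw [hq, hr]⟩
    unfold mstep; rw [hn, hr]
  | weaken i =>
    refine Or.inr (Or.inl ⟨i, rfl, ?_, by rw [hq, hr]⟩)
    unfold mstep; rw [hn, hr]
  | resolve i j x =>
    refine Or.inr (Or.inr ⟨i, j, x, rfl, ?_, by rw [hq, hr]⟩)
    unfold mstep
    rw [hn, hr, hq, hr]
    unfold Ctx.answer
    cases htr : X.toRead s.cur x s.hist <;> simp [htr]

/-- Out of range the process stays. -/
theorem Ctx.mstep_of_ge (c : Fin X.k × Fin m → Bool) (s : PState) (hcur : X.π.length ≤ s.cur) :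
    mstep X.query X.next c s = s := by
  unfold mstep Ctx.next
  rw [List.getElem?_eq_none_iff.2 hcur]

/-- `run` unfolded at the end. -/
theorem Ctx.run_succ (c : Fin X.k × Fin m → Bool) (n : ℕ) :
    X.run c (n + 1) = mstep X.query X.next c (X.run c n) := mrun_succ _ _ _

end Step

/-- Registered sub-goal `spc_process_anchor` of stmt-PneNP-9818 (credits this auxiliary file): the coin flag
of an answer is whether a coin is read (closed form of `Ctx.answer_snd`). -/
theorem spc_process_anchor : ∀ (m : ℕ) (X : Ctx m) (c : Fin X.k × Fin m → Bool) (a x : ℕ) (h : List Ev),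
    (X.answer c a x h).2 = (X.toRead a x h).isSome :=
  fun _ _ c a x h => Ctx.answer_snd c a x h

end Summit.PneNP.PneNP.Cruxes.RegularResolutionRung.SoundPathBottleneck
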